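import Summits.BirchSwinnertonDyer.BirchSwinnertonDyer.Theorems.GenusKolyvaginAtTwoGenusPrimitiveSupplyAtTwoDoorSupplyNegDisc
import Summits.BirchSwinnertonDyer.BirchSwinnertonDyer.Theorems.GenusKolyvaginAtTwoGenusPrimitiveSupplyAtTwoDoorSupplySlice
import Summits.BirchSwinnertonDyer.BirchSwinnertonDyer.Theorems.GenusKolyvaginAtTwoCasselsTateNumberField
import Literature.NumberTheory.EllipticCurves.SelmerGroupCardinality
import HarnessLib

/-!
# Route `GenusKolyvaginAtTwo`, crux #2 `GenusPrimitiveSupplyAtTwo` (stmt-BirchSwinnertonDyer-22136):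
# THE DOOR SUPPLY AT `Δ < 0` ON THE RANK-ONE HABITAT WITH `Ш(W)[2^∞]` FINITE
# (`#Ш(E/K)[p] = p^{2r}`; `#Sel₂(W) = 2^{2r+1}` for rank one and `E(ℚ)[2] = 0`; the door corollary of `…DoorSupplyNegDisc`)

Width seat `bsd-line-gk2-p4` g15 (cell `bsd-f1-sign2`), APPENDIX to `…DoorSupplyNegDisc` (p680217). THEOREMS ONLY (no definition, no named fact,
no `sorry`); helper `--supports stmt-BirchSwinnertonDyer-22136`; no item is closed; BSD is not proved by any of this.

WHY. `…DoorSupplyNegDisc.exists_doorAdmissible_twistSelmerTwoCard_eq_one_of_negDisc` supplies, at `Δ_W < 0` and `E(ℚ)[2] = 0`, a door-admissible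
Heegner field with `Sel₂(W^{(d_K)}) = 0` whenever `#Sel₂(W) = 2^k` with `k` ODD. On the habitat of the route (rank one) the parity of `k` is the
parity of `dim Ш(W)[2]`, and `dim Ш(W)[2]` is EVEN as soon as the `2`-primary part `Ш(W)[2^∞]` is finite: the LEAD's unconditional hyperbolic
structure `Ш(E/K)[p^∞] ≃ L × L` (`GenusExact.CasselsTateNumberField.exists_addEquiv_prod_self_primaryComponent_sha`, Cassels–Tate + Wall) restricts
to `Ш[p] ≃ L[p] × L[p]`. This file does that bookkeeping once, for every number field and every prime, and reads off the door:

* §48 `natCard_torsionBy_congr`, `natCard_torsionBy_prod`, `exists_natCard_eq_prime_pow_of_forall_smul_eq_zero` — group-theory plumbing;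
* §49 `exists_natCard_sha_torsionBy_eq_prime_pow_two_mul` — `#Ш(E/K)[p] = p^{2r}` for every number field `K : Type`, every prime `p`, whenever
  `Ш(E/K)[p^∞]` is finite (in the currency `Ш ⊓ H¹(K, E)[p]` of the tree's descent count `card_selmerGroup_eq_pow_rank_mul`);
* §50 `exists_natCard_selmerGroup_two_eq_pow_odd_of_rank_one` — rank one, `E(ℚ)[2] = 0`, `Ш(W)[2^∞]` finite ⟹ `#Sel₂(W) = 2^{2r+1}`;
* §51 `exists_doorAdmissible_twistSelmerTwoCard_eq_one_of_negDisc_of_rank_one` (and the `ShaFinite` reading `…_of_shaFinite`) — `Δ_W < 0`,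
  `E(ℚ)[2] = 0`, rank one, `Ш(W)[2^∞]` finite ⟹ an imaginary quadratic `K`, `d_K` door-admissible, `#Sel₂(W^{(d_K)}) = 1`, `(d_K, N_W) = 1`, Heegner;
  `exists_doorAdmissible_twistSelmerTwoCard_eq_one_of_negDisc_or_shaTwoTrivial` — the same on the union habitat
  `{Δ < 0, Ш[2^∞] finite} ∪ {Ш[2] = 0, Δ ∉ ℚ²}` (second piece: `…DoorSupplySlice`).

So on `{Δ < 0}` the fkl supply `RankOneAtTwoOneDoor.DoorSupplyAtTwo` holds for every rank-one `W` with `E(ℚ)[2] = 0` whose `Ш[2^∞]` is finite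
(e.g. analytic rank one, by Kolyvagin) — `Ш(W)[2] ≠ 0` allowed; what it does NOT give is the door for an infinite `Ш[2^∞]` (then `dim Sel₂` may be
even and every Heegner twist has `Sel₂ ≠ 0` by parity) nor anything at `Δ > 0` beyond the slice `Ш[2] = 0` (`…DoorSupplySlice`).

References: Mazur–Rubin, *Ranks of twists of elliptic curves and Hilbert's tenth problem*, Invent. Math. 181 (2010), Prop. 3.3, Cor. 3.4, Lemma 3.5;
Cassels, *Arithmetic on curves of genus 1, IV*, Crelle 211 (1962), §1; Wall, *Quadratic forms on finite groups*, Topology 2 (1963), Lemma 7;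
Silverman, *AEC* 2nd ed., Thm. X.4.2, X.4.14.
-/

set_option linter.dupNamespace false -- tree convention: `Summit.BirchSwinnertonDyer.BirchSwinnertonDyer.Theorems` (summit = sub-problem)
set_option autoImplicit false

noncomputable section

open scoped Classical

namespace Summit.BirchSwinnertonDyer.BirchSwinnertonDyer.Theorems.GenusKolyTransp

open WeierstrassCurve Field NumberField
open Literature.NumberTheory.EllipticCurves
open Summit.BirchSwinnertonDyer.Rank1Residual.F1Sign2
open Summit.BirchSwinnertonDyer.Rank1Residual.F1Sign2.EggDoubling (eq_zero_of_two_smul_eq_zero)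
open Summit.BirchSwinnertonDyer.BirchSwinnertonDyer.Theorems.RankOneAtTwoOneDoor (DoorAdmissible)
open Summit.BirchSwinnertonDyer.BirchSwinnertonDyer.Theorems.GenusExact.CasselsTateNumberField
  (exists_addEquiv_prod_self_primaryComponent_sha)

/-! ## §48 Group-theory plumbing: `n`-torsion under isomorphisms and products; groups killed by `p` -/

section GroupTheory

variable {G H : Type*} [AddCommGroup G] [AddCommGroup H]

/-- `#G[n] = #H[n]` for `G ≃+ H`. [folklore] -/
theorem natCard_torsionBy_congr (e : G ≃+ H) (n : ℕ) :
    Nat.card (AddSubgroup.torsionBy G n) = Nat.card (AddSubgroup.torsionBy H n) := by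
  refine Nat.card_congr (e.toEquiv.subtypeEquiv fun g ↦ ?_)
  rw [AddSubgroup.torsionBy.nsmul_iff, AddSubgroup.torsionBy.nsmul_iff]
  change n • g = 0 ↔ n • e g = 0
  rw [← map_nsmul, AddEquiv.map_eq_zero_iff]

/-- `#(G × H)[n] = #G[n] · #H[n]`. [folklore] -/
theorem natCard_torsionBy_prod (n : ℕ) :
    Nat.card (AddSubgroup.torsionBy (G × H) n) = Nat.card (AddSubgroup.torsionBy G n) * Nat.card (AddSubgroup.torsionBy H n) := by
  rw [← Nat.card_prod]
  refine Nat.card_congr ⟨fun x ↦ (⟨x.1.1, ?_⟩, ⟨x.1.2, ?_⟩), fun y ↦ ⟨(y.1.1, y.2.1), ?_⟩, fun x ↦ rfl, fun y ↦ rfl⟩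
  · have h := AddSubgroup.torsionBy.nsmul_iff.mp x.2
    rw [Prod.ext_iff] at h
    exact AddSubgroup.torsionBy.nsmul_iff.mpr (by simpa using h.1)
  · have h := AddSubgroup.torsionBy.nsmul_iff.mp x.2
    rw [Prod.ext_iff] at h
    exact AddSubgroup.torsionBy.nsmul_iff.mpr (by simpa using h.2)
  · exact AddSubgroup.torsionBy.nsmul_iff.mpr
      (Prod.ext (by simpa using AddSubgroup.torsionBy.nsmul_iff.mp y.1.2) (by simpa using AddSubgroup.torsionBy.nsmul_iff.mp y.2.2))

/-- A finite abelian group killed by the prime `p` has order a power of `p`. [folklore] -/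
theorem exists_natCard_eq_prime_pow_of_forall_smul_eq_zero (p : ℕ) [Fact p.Prime] (X : Type*) [AddCommGroup X] [Finite X]
    (h : ∀ x : X, p • x = 0) : ∃ m : ℕ, Nat.card X = p ^ m := by
  have hG : IsPGroup p (Multiplicative X) := by
    intro g
    refine ⟨1, ?_⟩
    rw [pow_one]
    change Multiplicative.ofAdd (p • (Multiplicative.toAdd g)) = Multiplicative.ofAdd 0
    congr 1
    exact h _
  obtain ⟨m, hm⟩ := IsPGroup.iff_card.mp hG
  exact ⟨m, by rw [← hm]; rfl⟩

/-- The `p`-torsion of a finite abelian group has order a power of `p`. [folklore] -/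
theorem exists_natCard_torsionBy_eq_prime_pow (p : ℕ) [Fact p.Prime] (X : Type*) [AddCommGroup X] [Finite X] :
    ∃ m : ℕ, Nat.card (AddSubgroup.torsionBy X p) = p ^ m :=
  exists_natCard_eq_prime_pow_of_forall_smul_eq_zero p _ fun x ↦ by
    exact_mod_cast AddSubgroup.torsionBy.nsmul x

end GroupTheory

/-! ## §49 `#Ш(E/K)[p] = p^{2r}` whenever `Ш(E/K)[p^∞]` is finite (every number field, every prime) -/

section Sha

variable {K : Type} [Field K] [NumberField K] (V : WeierstrassCurve K) [V.IsElliptic] (p : ℕ) [hp : Fact p.Prime]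

/-- **`#Ш(E/K)[p]` is an even power of `p` whenever `Ш(E/K)[p^∞]` is finite** — every number field `K : Type`, every prime `p`, in the currency
`Ш ⊓ H¹(K, E)[p]` of the descent count `card_selmerGroup_eq_pow_rank_mul`: the hyperbolic structure `Ш[p^∞] ≃ L × L` of the Cassels–Tate pairing
(`GenusExact.CasselsTateNumberField.exists_addEquiv_prod_self_primaryComponent_sha`) restricts to `Ш[p] ≃ L[p] × L[p]`.
[cite: Cassels1962ArithmeticIV, §1] [cite: Wall1963QuadraticFormsFiniteGroups, Lemma 7] [cite: SilvermanAEC2009, Thm. X.4.14] -/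
theorem exists_natCard_sha_torsionBy_eq_prime_pow_two_mul [Finite (AddCommGroup.primaryComponent V.sha p)] :
    ∃ r : ℕ, Nat.card (V.sha ⊓ AddSubgroup.torsionBy V.galH1 p : AddSubgroup V.galH1) = p ^ (2 * r) := by
  obtain ⟨L, ⟨e⟩⟩ := exists_addEquiv_prod_self_primaryComponent_sha V p
  -- `Ш ⊓ H¹[p] ≃ (Ш[p^∞])[p]`
  have h1 : Nat.card (V.sha ⊓ AddSubgroup.torsionBy V.galH1 p : AddSubgroup V.galH1) =
      Nat.card (AddSubgroup.torsionBy (AddCommGroup.primaryComponent V.sha p) p) := by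
    refine Nat.card_congr ⟨fun x ↦ ⟨⟨⟨x.1, (AddSubgroup.mem_inf.mp x.2).1⟩, ?_⟩, ?_⟩, fun y ↦ ⟨y.1.1.1, ?_⟩, fun x ↦ rfl, fun y ↦ rfl⟩
    · have hx : p • x.1 = 0 := AddSubgroup.torsionBy.nsmul_iff.mp (AddSubgroup.mem_inf.mp x.2).2
      exact (AddCommGroup.mem_primaryComponent).mpr ⟨1, Subtype.ext (by rw [pow_one]; exact hx)⟩
    · have hx : p • x.1 = 0 := AddSubgroup.torsionBy.nsmul_iff.mp (AddSubgroup.mem_inf.mp x.2).2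
      exact AddSubgroup.torsionBy.nsmul_iff.mpr (Subtype.ext (Subtype.ext hx))
    · have hy : p • y.1 = 0 := AddSubgroup.torsionBy.nsmul_iff.mp y.2
      refine AddSubgroup.mem_inf.mpr ⟨y.1.1.2, AddSubgroup.torsionBy.nsmul_iff.mpr ?_⟩
      have := congrArg (fun z : AddCommGroup.primaryComponent V.sha p ↦ ((z : V.sha) : V.galH1)) hy
      simpa using this
  -- `#L[p] = p^r`
  haveI : Finite L := inferInstance
  obtain ⟨r, hr⟩ := exists_natCard_torsionBy_eq_prime_pow p L
  refine ⟨r, ?_⟩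
  rw [h1, natCard_torsionBy_congr e p, natCard_torsionBy_prod, hr, ← pow_add, two_mul]

/-- **`#Ш(E/K)[p] = p^{2r}` when `Ш(E/K)` is finite** (the `ShaFinite` reading of the previous theorem). [cite: SilvermanAEC2009, Thm. X.4.14] -/
theorem exists_natCard_sha_torsionBy_eq_prime_pow_two_mul_of_shaFinite (hfin : V.ShaFinite) :
    ∃ r : ℕ, Nat.card (V.sha ⊓ AddSubgroup.torsionBy V.galH1 p : AddSubgroup V.galH1) = p ^ (2 * r) := by
  haveI : Finite V.sha := hfin
  exact exists_natCard_sha_torsionBy_eq_prime_pow_two_mul V p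

end Sha

/-! ## §50 `#Sel₂(W) = 2^{2r+1}` for rank one, `E(ℚ)[2] = 0`, `Ш(W)[2^∞]` finite -/

section Rat

variable (W : WeierstrassCurve ℚ) [W.IsElliptic]

/-- **`#Sel₂(W) = 2^{2r+1}` for rank one, `E(ℚ)[2] = 0` and `Ш(W)[2^∞]` finite** — the descent count `#Sel₂ = 2^{rank} · #E(ℚ)[2] · #Ш[2]`
(`card_selmerGroup_eq_pow_rank_mul`) with `#Ш[2] = 2^{2r}` (§49). [cite: SilvermanAEC2009, Thm X.4.2(a), Thm. X.4.14] -/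
theorem exists_natCard_selmerGroup_two_eq_pow_odd_of_rank_one (hT : NoRationalTwoTorsion W) (hrank : W.mordellWeilRank = 1)
    [Finite (AddCommGroup.primaryComponent W.sha 2)] : ∃ r : ℕ, Nat.card (W.selmerGroup 2) = 2 ^ (2 * r + 1) := by
  -- `E(ℚ)`'s group law takes a `DecidableEq ℚ`; the general descent count carries the classical instance: transport along `Subsingleton.elim`
  -- (as in `GenusKolyArch.selmerTwoCard_eq_two_of_rank_one`).
  have hinst : (instDecidableEqRat : DecidableEq ℚ) = fun a b => Classical.propDecidable (a = b) := Subsingleton.elim _ _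
  have ht : Nat.card (AddSubgroup.torsionBy W.toAffine.Point ((2 : ℕ) : ℤ)) = 1 := by
    have hbot : AddSubgroup.torsionBy W.toAffine.Point ((2 : ℕ) : ℤ) = ⊥ :=
      (AddSubgroup.eq_bot_iff_forall _).mpr fun P hP ↦
        eq_zero_of_two_smul_eq_zero W hT P (AddSubgroup.torsionBy.nsmul_iff.mp hP)
    rw [hbot, AddSubgroup.card_bot]
  rw [hinst] at ht
  obtain ⟨r, hr⟩ := exists_natCard_sha_torsionBy_eq_prime_pow_two_mul W 2
  have h := card_selmerGroup_eq_pow_rank_mul W 2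
  rw [ht, hrank, mul_one, pow_one, hr, Nat.cast_ofNat] at h
  refine ⟨r, ?_⟩
  rw [h, pow_succ']

/-! ## §51 The door at `Δ < 0` on the rank-one habitat with `Ш(W)[2^∞]` finite -/

/-- **THE DOOR SUPPLY AT `Δ < 0`, RANK ONE, `Ш(W)[2^∞]` FINITE.** `W/ℚ` globally minimal elliptic, `Δ_W < 0`, `E(ℚ)[2] = 0`, `rank E(ℚ) = 1`,
`Ш(W)[2^∞]` finite (`Ш(W)[2] ≠ 0` allowed): there is an imaginary quadratic `K` with `d_K` door-admissible, `#Sel₂(W^{(d_K)}) = 1`, `(d_K, N_W) = 1` and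
the Heegner hypothesis — the conclusion of `RankOneAtTwoOneDoor.DoorSupplyAtTwo` on `{Δ < 0, Ш[2^∞] finite}`; `…DoorSupplyNegDisc` at `k = 2r + 1` (§50).
[cite: MazurRubin2010, Prop. 3.3, Cor. 3.4 (i), Lemma 3.5] [cite: SilvermanAEC2009, Thm. X.4.14] -/
theorem exists_doorAdmissible_twistSelmerTwoCard_eq_one_of_negDisc_of_rank_one [W.IsGloballyMinimal] [NeZero (W.conductorNorm ℤ)]
    (hΔ : W.Δ < 0) (hT : NoRationalTwoTorsion W) (hrank : W.mordellWeilRank = 1) [Finite (AddCommGroup.primaryComponent W.sha 2)] :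
    ∃ (K : Type) (_ : Field K) (_ : NumberField K),
      IsImaginaryQuadratic K ∧ DoorAdmissible W (NumberField.discr K) ∧ twistSelmerTwoCard W (NumberField.discr K) = 1 ∧
      Nat.Coprime (NumberField.discr K).natAbs (W.conductorNorm ℤ) ∧ SatisfiesHeegnerHypothesis (W.conductorNorm ℤ) K := by
  obtain ⟨r, hr⟩ := exists_natCard_selmerGroup_two_eq_pow_odd_of_rank_one W hT hrank
  exact exists_doorAdmissible_twistSelmerTwoCard_eq_one_of_negDisc W hΔ hT hr ⟨r, rfl⟩

/-- **THE DOOR SUPPLY AT `Δ < 0`, RANK ONE, `Ш(W)` FINITE** (the `ShaFinite` reading). [cite: MazurRubin2010, Prop. 3.3, Cor. 3.4 (i), Lemma 3.5] -/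
theorem exists_doorAdmissible_twistSelmerTwoCard_eq_one_of_negDisc_of_shaFinite [W.IsGloballyMinimal] [NeZero (W.conductorNorm ℤ)]
    (hΔ : W.Δ < 0) (hT : NoRationalTwoTorsion W) (hrank : W.mordellWeilRank = 1) (hfin : W.ShaFinite) :
    ∃ (K : Type) (_ : Field K) (_ : NumberField K),
      IsImaginaryQuadratic K ∧ DoorAdmissible W (NumberField.discr K) ∧ twistSelmerTwoCard W (NumberField.discr K) = 1 ∧
      Nat.Coprime (NumberField.discr K).natAbs (W.conductorNorm ℤ) ∧ SatisfiesHeegnerHypothesis (W.conductorNorm ℤ) K := by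
  haveI : Finite W.sha := hfin
  exact exists_doorAdmissible_twistSelmerTwoCard_eq_one_of_negDisc_of_rank_one W hΔ hT hrank

/-- **THE `L`-FREE DOOR SUPPLY ON THE UNION HABITAT `{Δ < 0, Ш[2^∞] finite} ∪ {Ш[2] = 0, Δ ∉ ℚ²}`** (rank one, `E(ℚ)[2] = 0`): the
conclusion of `RankOneAtTwoOneDoor.DoorSupplyAtTwo` — an imaginary quadratic `K`, `d_K` door-admissible, `#Sel₂(W^{(d_K)}) = 1`, `(d_K, N_W) = 1`,
Heegner — from §51 on the first piece and `…DoorSupplySlice.exists_doorAdmissible_twistSelmerTwoCard_eq_one` (the three doors) on the second.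
What is NOT covered: `Δ > 0` with `Ш(W)[2] ≠ 0`, and square `Δ`. [cite: MazurRubin2010, Prop. 3.3, Cor. 3.4 (i), Lemma 3.5] [cite: Kramer1981, Prop. 3] -/
theorem exists_doorAdmissible_twistSelmerTwoCard_eq_one_of_negDisc_or_shaTwoTrivial [W.IsGloballyMinimal] [NeZero (W.conductorNorm ℤ)]
    (hT : NoRationalTwoTorsion W) (hrank : W.mordellWeilRank = 1)
    (h : (W.Δ < 0 ∧ Finite (AddCommGroup.primaryComponent W.sha 2)) ∨ (ShaTwoTrivial W ∧ ¬ IsSquare W.Δ)) :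
    ∃ (K : Type) (_ : Field K) (_ : NumberField K),
      IsImaginaryQuadratic K ∧ DoorAdmissible W (NumberField.discr K) ∧ twistSelmerTwoCard W (NumberField.discr K) = 1 ∧
      Nat.Coprime (NumberField.discr K).natAbs (W.conductorNorm ℤ) ∧ SatisfiesHeegnerHypothesis (W.conductorNorm ℤ) K := by
  rcases h with ⟨hΔ, hfin⟩ | ⟨hSha, hnsq⟩
  · haveI := hfin
    exact exists_doorAdmissible_twistSelmerTwoCard_eq_one_of_negDisc_of_rank_one W hΔ hT hrank
  · exact exists_doorAdmissible_twistSelmerTwoCard_eq_one W hnsq hT hrank hSha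

end Rat

end Summit.BirchSwinnertonDyer.BirchSwinnertonDyer.Theorems.GenusKolyTransp

end
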